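import Summits.BirchSwinnertonDyer.BirchSwinnertonDyer.Theorems.ResidualThetaTransportAtTwoThetaLayerLambdaCongruenceAtTwoCuspSpanRowsTwoFour
import HarnessLib

/-!
# Route `ResidualThetaTransportAtTwo`, cruxes Kan⁺ (stmt-BirchSwinnertonDyer-20688) / node 27436 / 21437: the 2-POWER DESCENT —
# the node (G′)_N at EVERY odd level `N = p^a q^b` (two distinct primes, all exponents)

Cell `bsd-wall`, width seat `bsd-wall-rtt-p3-w3` g8 (2026-08-28), lane «2-power descent». THEOREMS ONLY;
`--supports stmt-BirchSwinnertonDyer-20688`; BSD is not proved by this.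

Context. At an odd composite level the node (G′)_N (`CuspSpanEvenAtTwo N`) is EQUIVALENT to the pure generation statement
(G‴)_N «every additive `χ : Γ₀(N) → 𝔽₂` killing the elements of trace `0, ±1, ±2`, the elements with `|d| = 4^k` (`k ≥ 1`) and the
row `B₁ = {b = −1}` vanishes» (`rtt-p3-w4` g2, `cuspSpanEvenAtTwo_of_forall_b1_odd`, p638351), and such a `χ` also kills the rows
`|b| = 2` and `|b| = 4^i` (`…CuspSpanRowsTwoFour`, p639370). The lead's descent `chi_eq_zero_of_forall_b1` (p621005) reduces `|b(γ)|`
by right multiplication with a `B₁` element `(∗, −1; ∗, δ)`, `δ ∈ {⌊a/b⌋, ⌈a/b⌉}` a unit mod `N` — which needs (SUCC) «of two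
consecutive integers one is a unit», i.e. `N` a prime power. HERE the descent uses the rows `|b| = 2^j` as well:

* §1 `chi_eq_zero_of_descent` — ABSTRACT 2-POWER DESCENT: right multiplication by `η = (x, −2^j; Nz, w)` sends `b ↦ bw − 2^j a`;
  if every coprime `(a, b)` (`a` prime to `bN`, `|b| ≥ 2`, `|b| ≠ 2^i` for `i ≤ J`) admits `j ≤ J` and `w` prime to `2^j N` with
  `|bw − 2^j a| < |b|`, then an additive `χ` killing the small-trace elements and the rows `|b| = 2^j`, `j ≤ J`, vanishes.
* §2 the CANDIDATES: `q₀ = ⌊a/b⌋`, `q₀ + 1` (`j = 0`) and `w_j = 2⌊2^{j−1}a/b⌋ + 1` (`j ≥ 1`, odd, `|b w_j − 2^j a| = |b − 2r| < |b|`);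
  the chain `w₁ = 2q₀ + 1`, `w_{j+1} = 2w_j ± 1`.
* §3 `exists_candidate_of_card_primeFactors_le_two` — for `ω(N) ≤ 2` one of `q₀, q₀+1, 2q₀+1` is prime to `N` (a prime dividing
  `q₀` or `q₀ + 1` cannot divide `2q₀ + 1`), so `J = 1` suffices; hence
  **`cuspSpanEvenAtTwo_of_card_primeFactors_le_two : Odd N → N.primeFactors.card ≤ 2 → CuspSpanEvenAtTwo N`** — the node at every
  `N = p^a q^b` (in particular `135 = 3³·5`, `225`, `675`, `2025`, `3375`, where the `B₁` classes alone do NOT span, rtt-p4-w2 g6),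
  `cuspSpanEvenAtTwo_primePow_mul_primePow`, and FLAT for every `W` good supersingular at `2` with `a₂ = 0` of such a conductor.
Three distinct primes need `J = 3` (the row `|b| = 8`): sequel `…CuspSpanThreePrimes`.

References: [Rademacher1929] §1 (generators of `Γ₀(N)`); [Knapp1993] Prop. 11.1; [Pollack2003] Conj. 6.3.
-/

set_option autoImplicit false
set_option linter.dupNamespace false

noncomputable section

open scoped MatrixGroups

open CongruenceSubgroup WeierstrassCurve Literature.NumberTheory.EllipticCurves
  Literature.NumberTheory.EllipticCurves.ModularForms Literature.NumberTheory.EllipticCurves.Rank1Residual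
  Literature.NumberTheory.IwasawaTheory Summit.BirchSwinnertonDyer.Rank1Residual.Supersingular

namespace Summit.BirchSwinnertonDyer.BirchSwinnertonDyer.Theorems.SignedMuAtTwo

namespace TwoPow

variable {N : ℕ} {χ : Gamma0 N → ZMod 2}

/-! ## §1. The abstract 2-power descent -/

/-- **2-power descent.** Let `χ : Γ₀(N) → 𝔽₂` be additive, kill the elements of trace `0, ±1, ±2` and every element whose
upper-right entry has absolute value `2^j` for some `j ≤ J`. Suppose every pair `(a, b)` with `a` prime to `bN`, `|b| ≥ 2` and
`|b| ≠ 2^i` (`i ≤ J`) admits `j ≤ J` and `w` prime to `2^j N` with `|b w − 2^j a| < |b|`. Then `χ = 0`: right multiplication by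
`η = (x, −2^j; Nz, w)` (killed) lowers `|b|`. [cite: Rademacher1929, §1] -/
theorem chi_eq_zero_of_descent (J : ℕ)
    (hdesc : ∀ a b : ℤ, IsCoprime a (b * N) → 2 ≤ b.natAbs → (∀ i : ℕ, i ≤ J → b.natAbs ≠ 2 ^ i) →
      ∃ j : ℕ, j ≤ J ∧ ∃ w : ℤ, IsCoprime w (2 ^ j * N) ∧ (b * w - 2 ^ j * a).natAbs < b.natAbs)
    (hadd : ∀ γ δ : Gamma0 N, χ (γ * δ) = χ γ + χ δ)
    (hsmall : ∀ γ : Gamma0 N, ((γ : SL(2, ℤ)) 0 0 + (γ : SL(2, ℤ)) 1 1).natAbs ≤ 2 → χ γ = 0)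
    (hrows : ∀ j : ℕ, j ≤ J → ∀ γ : Gamma0 N, ((γ : SL(2, ℤ)) 0 1).natAbs = 2 ^ j → χ γ = 0) :
    ∀ γ : Gamma0 N, χ γ = 0 := by
  suffices h : ∀ n : ℕ, ∀ γ : Gamma0 N, ((γ : SL(2, ℤ)) 0 1).natAbs = n → χ γ = 0 from fun γ ↦ h _ γ rfl
  intro n
  induction n using Nat.strong_induction_on with
  | _ n ih =>
  intro γ hn
  have hdet : (γ : SL(2, ℤ)) 0 0 * (γ : SL(2, ℤ)) 1 1 - (γ : SL(2, ℤ)) 0 1 * (γ : SL(2, ℤ)) 1 0 = 1 := by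
    have := Matrix.SpecialLinearGroup.det_coe (γ : SL(2, ℤ))
    rwa [Matrix.det_fin_two] at this
  rcases Nat.lt_or_ge n 2 with hlt | hge
  · interval_cases n
    · have hb0 : (γ : SL(2, ℤ)) 0 1 = 0 := Int.natAbs_eq_zero.mp hn
      rw [hb0, zero_mul, sub_zero] at hdet
      refine hsmall γ ?_
      rcases Int.eq_one_or_neg_one_of_mul_eq_one' hdet with ⟨ha, hd⟩ | ⟨ha, hd⟩ <;> rw [ha, hd] <;> rfl
    · exact hrows 0 (Nat.zero_le J) γ (by rw [hn, pow_zero])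
  · by_cases hpow : ∃ i : ℕ, i ≤ J ∧ n = 2 ^ i
    · obtain ⟨i, hi, rfl⟩ := hpow
      exact hrows i hi γ hn
    · push Not at hpow
      have hcop : IsCoprime ((γ : SL(2, ℤ)) 0 0) ((γ : SL(2, ℤ)) 0 1 * N) := isCoprime_apply_zero_zero_mul γ
      obtain ⟨j, hj, w, hw, hlt⟩ := hdesc _ _ hcop (hn ▸ hge) (fun i hi ↦ hn ▸ hpow i hi)
      obtain ⟨x, y, hxy⟩ := hw
      obtain ⟨η, hη00, hη01, hη10, hη11⟩ := ThetaLayerLambdaCongruenceAtTwo.exists_gamma0_entries (N := N)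
        x (-(2 ^ j)) ((N : ℤ) * y) w (by linear_combination hxy) (dvd_mul_right _ _)
      have hη : χ η = 0 := hrows j hj η (by rw [hη01, Int.natAbs_neg, Int.natAbs_pow]; rfl)
      have hγη : ((γ * η : Gamma0 N) : SL(2, ℤ)) 0 1 = (γ : SL(2, ℤ)) 0 1 * w - 2 ^ j * (γ : SL(2, ℤ)) 0 0 := by
        rw [gamma0_mul_apply_zero_one, hη01, hη11]; ring
      have hlt' : (((γ * η : Gamma0 N) : SL(2, ℤ)) 0 1).natAbs < n := by rw [hγη, ← hn]; exact hlt
      exact chi_eq_zero_of_mul_right hadd (ih _ hlt' (γ * η) rfl) hη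

/-! ## §2. The candidates `⌊a/b⌋`, `⌊a/b⌋ + 1`, `2⌊2^{j−1} a/b⌋ + 1` -/

/-- `|b ⌊a/b⌋ − a| < |b|` for `b > 0`. [folklore] -/
theorem natAbs_mul_ediv_sub_lt {a b : ℤ} (hb : 0 < b) : (b * (a / b) - a).natAbs < b.natAbs := by
  have hqr : b * (a / b) + a % b = a := Int.mul_ediv_add_emod a b
  have hr0 : 0 ≤ a % b := Int.emod_nonneg a hb.ne'
  have hrb : a % b < b := Int.emod_lt_of_pos a hb
  have e : b * (a / b) - a = -(a % b) := by linear_combination hqr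
  rw [e, Int.natAbs_neg]
  have h1 : ((a % b).natAbs : ℤ) = a % b := Int.natAbs_of_nonneg hr0
  have h2 : (b.natAbs : ℤ) = b := Int.natAbs_of_nonneg hb.le
  omega

/-- `|b (⌊a/b⌋ + 1) − a| < |b|` for `b > 0`, `b ∤ a`. [folklore] -/
theorem natAbs_mul_ediv_add_one_sub_lt {a b : ℤ} (hb : 0 < b) (hba : ¬ b ∣ a) :
    (b * (a / b + 1) - a).natAbs < b.natAbs := by
  have hqr : b * (a / b) + a % b = a := Int.mul_ediv_add_emod a b
  have hr0 : 0 ≤ a % b := Int.emod_nonneg a hb.ne'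
  have hrb : a % b < b := Int.emod_lt_of_pos a hb
  have hrne : a % b ≠ 0 := fun h ↦ hba (Int.dvd_of_emod_eq_zero h)
  have e : b * (a / b + 1) - a = b - a % b := by linear_combination hqr
  rw [e]
  have h2 : (b.natAbs : ℤ) = b := Int.natAbs_of_nonneg hb.le
  have h3 : ((b - a % b).natAbs : ℤ) = b - a % b := Int.natAbs_of_nonneg (by omega)
  omega

/-- **The odd candidate of level `j ≥ 1`**: `w = 2⌊m/b⌋ + 1` with `m = 2^{j−1} a` satisfies `|b w − 2m| = |b − 2 (m mod b)| < |b|`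
for `b > 0`, `b ∤ m`. [folklore] -/
theorem natAbs_mul_odd_candidate_sub_lt {m b : ℤ} (hb : 0 < b) (hbm : ¬ b ∣ m) :
    (b * (2 * (m / b) + 1) - 2 * m).natAbs < b.natAbs := by
  have hqr : b * (m / b) + m % b = m := Int.mul_ediv_add_emod m b
  have hr0 : 0 ≤ m % b := Int.emod_nonneg m hb.ne'
  have hrb : m % b < b := Int.emod_lt_of_pos m hb
  have hrne : m % b ≠ 0 := fun h ↦ hbm (Int.dvd_of_emod_eq_zero h)
  have e : b * (2 * (m / b) + 1) - 2 * m = b - 2 * (m % b) := by linear_combination 2 * hqr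
  rw [e]
  have h2 : (b.natAbs : ℤ) = b := Int.natAbs_of_nonneg hb.le
  have h3 : ((b - 2 * (m % b)).natAbs : ℤ) = |b - 2 * (m % b)| := Int.natCast_natAbs _
  have h4 : |b - 2 * (m % b)| < b := abs_lt.mpr ⟨by omega, by omega⟩
  omega

/-- **The chain step**: `2⌊2m/b⌋ + 1 = 2 (2⌊m/b⌋ + 1) + s` with `s = ±1` (`b > 0`). [folklore] -/
theorem exists_sign_candidate_succ {m b : ℤ} (hb : 0 < b) :
    ∃ s : ℤ, (s = 1 ∨ s = -1) ∧ 2 * (2 * m / b) + 1 = 2 * (2 * (m / b) + 1) + s := by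
  have hqr : b * (m / b) + m % b = m := Int.mul_ediv_add_emod m b
  have hr0 : 0 ≤ m % b := Int.emod_nonneg m hb.ne'
  have hrb : m % b < b := Int.emod_lt_of_pos m hb
  have e : 2 * m = 2 * (m % b) + 2 * (m / b) * b := by linear_combination -2 * hqr
  have hdiv : 2 * m / b = 2 * (m % b) / b + 2 * (m / b) := by
    rw [e, Int.add_mul_ediv_right _ _ hb.ne']
  have h0 : 0 ≤ 2 * (m % b) / b := Int.ediv_nonneg (by omega) hb.le
  have h1 : 2 * (m % b) / b < 2 := (Int.ediv_lt_iff_lt_mul hb).mpr (by omega)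
  rcases (show 2 * (m % b) / b = 0 ∨ 2 * (m % b) / b = 1 by omega) with h | h
  · exact ⟨-1, Or.inr rfl, by rw [hdiv, h]; ring⟩
  · exact ⟨1, Or.inl rfl, by rw [hdiv, h]; ring⟩

/-- If `IsCoprime a b` and `b ∣ 2^i a` then `|b| = 2^e` for some `e ≤ i`. [folklore] -/
theorem eq_two_pow_of_dvd_two_pow_mul {a b : ℤ} (hab : IsCoprime a b) (i : ℕ) (hdvd : b ∣ 2 ^ i * a) :
    ∃ e : ℕ, e ≤ i ∧ b.natAbs = 2 ^ e := by
  have h1 : b ∣ 2 ^ i := hab.symm.dvd_of_dvd_mul_right hdvd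
  have h2 : b.natAbs ∣ 2 ^ i := by
    have := Int.natAbs_dvd_natAbs.mpr h1
    rwa [Int.natAbs_pow] at this
  obtain ⟨e, he, heq⟩ := (Nat.dvd_prime_pow Nat.prime_two).mp h2
  exact ⟨e, he, heq⟩

/-- An odd integer prime to `N` is prime to `2^j N`. [folklore] -/
theorem isCoprime_two_pow_mul_of_odd {w : ℤ} (hw : Odd w) (hwN : IsCoprime w N) (j : ℕ) :
    IsCoprime w (2 ^ j * N) := by
  refine IsCoprime.mul_right ?_ hwN
  obtain ⟨k, hk⟩ := hw
  have h2 : IsCoprime w 2 := ⟨1, -k, by rw [hk]; ring⟩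
  exact h2.pow_right

/-- An integer none of whose prime divisors divides `N ≠ 0`... precisely: if no prime factor of `N` divides `w` then `w` is prime
to `N`. [folklore] -/
theorem isCoprime_of_forall_primeFactors [NeZero N] {w : ℤ} (h : ∀ p ∈ N.primeFactors, ¬ (p : ℤ) ∣ w) :
    IsCoprime w N := by
  rw [Int.isCoprime_iff_gcd_eq_one]
  by_contra hg
  obtain ⟨p, hp, hpdvd⟩ := Nat.exists_prime_and_dvd hg
  have hpw : (p : ℤ) ∣ w := (Int.natCast_dvd_natCast.mpr (hpdvd.trans (Int.gcd_dvd_natAbs_left w N))).trans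
    Int.natAbs_dvd_self
  have hpN : p ∣ N := by
    have := hpdvd.trans (Int.gcd_dvd_natAbs_right w N)
    simpa using this
  exact h p (Nat.mem_primeFactors.mpr ⟨hp, hpN, NeZero.ne N⟩) hpw

/-- A prime cannot divide two integers differing by `±1`... in the form used: `p ∣ x`, `p ∣ y`, `u x + v y = 1` is absurd.
[folklore] -/
theorem not_prime_dvd_of_combination {p : ℕ} (hp : p.Prime) {x y : ℤ} (u v : ℤ) (h : u * x + v * y = 1)
    (hx : (p : ℤ) ∣ x) (hy : (p : ℤ) ∣ y) : False := by
  have h1 : (p : ℤ) ∣ 1 := by rw [← h]; exact Dvd.dvd.add (hx.mul_left u) (hy.mul_left v)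
  have := Int.eq_one_of_dvd_one (by exact_mod_cast hp.pos.le) h1
  exact hp.one_lt.ne' (by exact_mod_cast this)

/-- `p ∣ x`, `p ∣ y`, `u x + v y = 3`, `p` prime ⟹ `p = 3`. [folklore] -/
theorem eq_three_of_combination {p : ℕ} (hp : p.Prime) {x y : ℤ} (u v : ℤ) (h : u * x + v * y = 3)
    (hx : (p : ℤ) ∣ x) (hy : (p : ℤ) ∣ y) : p = 3 := by
  have h1 : (p : ℤ) ∣ 3 := by rw [← h]; exact Dvd.dvd.add (hx.mul_left u) (hy.mul_left v)
  have h2 : p ∣ 3 := by exact_mod_cast h1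
  exact (Nat.prime_dvd_prime_iff_eq hp Nat.prime_three).mp h2

/-! ## §3. Two distinct primes: the chain is free by step 1 -/

/-- **`ω(N) ≤ 2`: one of `q, q+1, 2q+1` is prime to `N`.** A prime dividing `q` (resp. `q+1`) does not divide `2q+1`, and no prime
divides both `q` and `q+1`; so if all three had a prime factor of `N`, `N` would have three distinct prime factors. [folklore] -/
theorem exists_coprime_of_card_primeFactors_le_two [NeZero N] (hω : N.primeFactors.card ≤ 2) (q : ℤ) :
    IsCoprime q N ∨ IsCoprime (q + 1) N ∨ IsCoprime (2 * q + 1) N := by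
  by_contra hcon
  push Not at hcon
  obtain ⟨h0, h1, h2⟩ := hcon
  have e0 : ∃ p ∈ N.primeFactors, (p : ℤ) ∣ q := by
    by_contra h; push Not at h; exact h0 (isCoprime_of_forall_primeFactors h)
  have e1 : ∃ p ∈ N.primeFactors, (p : ℤ) ∣ q + 1 := by
    by_contra h; push Not at h; exact h1 (isCoprime_of_forall_primeFactors h)
  have e2 : ∃ p ∈ N.primeFactors, (p : ℤ) ∣ 2 * q + 1 := by
    by_contra h; push Not at h; exact h2 (isCoprime_of_forall_primeFactors h)
  obtain ⟨p₀, hp₀, hd₀⟩ := e0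
  obtain ⟨p₁, hp₁, hd₁⟩ := e1
  obtain ⟨p₂, hp₂, hd₂⟩ := e2
  have pp₀ := (Nat.mem_primeFactors.mp hp₀).1
  have pp₁ := (Nat.mem_primeFactors.mp hp₁).1
  have pp₂ := (Nat.mem_primeFactors.mp hp₂).1
  have h01 : p₀ ≠ p₁ := by
    rintro rfl; exact not_prime_dvd_of_combination pp₀ (-1) 1 (by ring) hd₀ hd₁
  have h02 : p₀ ≠ p₂ := by
    rintro rfl; exact not_prime_dvd_of_combination pp₀ (-2) 1 (by ring) hd₀ hd₂
  have h12 : p₁ ≠ p₂ := by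
    rintro rfl; exact not_prime_dvd_of_combination pp₁ 2 (-1) (by ring) hd₁ hd₂
  have hsub : ({p₀, p₁, p₂} : Finset ℕ) ⊆ N.primeFactors := by
    intro p hp
    simp only [Finset.mem_insert, Finset.mem_singleton] at hp
    rcases hp with rfl | rfl | rfl <;> assumption
  have hcard : ({p₀, p₁, p₂} : Finset ℕ).card = 3 := by
    rw [Finset.card_insert_of_notMem (by simp [h01, h02]), Finset.card_insert_of_notMem (by simp [h12]),
      Finset.card_singleton]
  have := Finset.card_le_card hsub
  omega

/-- **The descent hypothesis at `ω(N) ≤ 2`, with `J = 1`.** For `a` prime to `bN`, `|b| ≥ 2`: one of `w = ⌊a/b⌋`, `⌊a/b⌋ + 1`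
(`j = 0`) or `w = 2⌊a/b⌋ + 1` (`j = 1`, odd) is prime to `2^j N` and has `|bw − 2^j a| < |b|`. [folklore] -/
theorem descent_of_card_primeFactors_le_two [NeZero N] (hω : N.primeFactors.card ≤ 2) (a b : ℤ)
    (hab : IsCoprime a (b * N)) (hb : 2 ≤ b.natAbs) :
    ∃ j : ℕ, j ≤ 1 ∧ ∃ w : ℤ, IsCoprime w (2 ^ j * N) ∧ (b * w - 2 ^ j * a).natAbs < b.natAbs := by
  -- reduce to `b > 0`
  wlog hpos : 0 < b generalizing a b
  · have hb' : 2 ≤ (-b).natAbs := by rwa [Int.natAbs_neg]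
    have hab' : IsCoprime (-a) (-b * N) := by rw [neg_mul]; exact hab.neg_left.neg_right
    have hneg : 0 < -b := by
      rcases lt_trichotomy b 0 with h | h | h
      · omega
      · subst h; simp at hb
      · exact absurd h hpos
    obtain ⟨j, hj, w, hw, hlt⟩ := this (-a) (-b) hab' hb' hneg
    refine ⟨j, hj, w, hw, ?_⟩
    have e : b * w - 2 ^ j * a = -(-b * w - 2 ^ j * (-a)) := by ring
    rwa [e, Int.natAbs_neg, ← Int.natAbs_neg b]
  have hba : ¬ b ∣ a := by
    intro h
    have hu : IsUnit b := (hab.of_mul_right_left).symm.isUnit_of_dvd h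
    rcases Int.isUnit_iff.mp hu with h1 | h1 <;> rw [h1] at hb <;> norm_num at hb
  set q := a / b with hq
  rcases exists_coprime_of_card_primeFactors_le_two hω q with h | h | h
  · exact ⟨0, zero_le_one, q, by rw [pow_zero, one_mul]; exact h, by
      rw [pow_zero, one_mul]; exact natAbs_mul_ediv_sub_lt hpos⟩
  · exact ⟨0, zero_le_one, q + 1, by rw [pow_zero, one_mul]; exact h, by
      rw [pow_zero, one_mul]; exact natAbs_mul_ediv_add_one_sub_lt hpos hba⟩
  · refine ⟨1, le_rfl, 2 * q + 1, isCoprime_two_pow_mul_of_odd ⟨q, rfl⟩ h 1, ?_⟩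
    have e : b * (2 * q + 1) - 2 ^ 1 * a = b * (2 * (a / b) + 1) - 2 * a := by rw [hq]; ring
    rw [e]
    exact natAbs_mul_odd_candidate_sub_lt hpos hba

/-- **(G‴)_N at `ω(N) ≤ 2`.** For odd `N` with at most two distinct prime factors, every additive `χ : Γ₀(N) → 𝔽₂` killing the
small-trace elements, the `|d| = 4^k` elements and the row `b = −1` vanishes identically (rows `|b| = 1, 2` + the 2-power descent
with `J = 1`). [cite: Rademacher1929, §1] -/
theorem chi_eq_zero_of_card_primeFactors_le_two [NeZero N] (hN : Odd N) (hω : N.primeFactors.card ≤ 2)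
    (hadd : ∀ γ δ : Gamma0 N, χ (γ * δ) = χ γ + χ δ)
    (hsmall : ∀ γ : Gamma0 N, ((γ : SL(2, ℤ)) 0 0 + (γ : SL(2, ℤ)) 1 1).natAbs ≤ 2 → χ γ = 0)
    (hkill : ∀ γ : Gamma0 N, (∃ k : ℕ, 1 ≤ k ∧ ((γ : SL(2, ℤ)) 1 1).natAbs = 4 ^ k) → χ γ = 0)
    (hB1 : ∀ β : Gamma0 N, (β : SL(2, ℤ)) 0 1 = -1 → χ β = 0) : ∀ γ : Gamma0 N, χ γ = 0 := by
  refine chi_eq_zero_of_descent 1 (fun a b hab hb _ ↦ descent_of_card_primeFactors_le_two hω a b hab hb) hadd hsmall ?_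
  intro j hj γ hγ
  interval_cases j
  · exact forall_b1_of_forall_b_neg_one hadd hB1 γ (by rw [hγ, pow_zero])
  · exact chi_eq_zero_of_natAbs_b_eq_two_odd hN hadd hsmall hkill hB1 γ (by rw [hγ, pow_one])

/-- **`CuspSpanEvenAtTwo N` for every odd `N` with at most two distinct prime factors** — the node (G′)_N of 21437 / Kan⁺ / Kμ⁺ /
TP2-K1 at every level `p^a`, `p^a q^b` (odd primes, all exponents), uniformly, with no certificate and no conjecture-grade input.
BSD is not proved by this. [cite: Pollack2003, Conj. 6.3] [cite: Rademacher1929, §1] -/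
theorem cuspSpanEvenAtTwo_of_card_primeFactors_le_two [NeZero N] (hN : Odd N) (hω : N.primeFactors.card ≤ 2) :
    CuspSpanEvenAtTwo N :=
  cuspSpanEvenAtTwo_of_forall_b1_odd hN fun _ hadd hsmall hkill hB1 ↦
    chi_eq_zero_of_card_primeFactors_le_two hN hω hadd hsmall hkill hB1

/-- **`CuspSpanEvenAtTwo (p^a q^b)`** for odd primes `p, q` and all exponents (e.g. `135 = 3³·5`, `225 = 3²·5²`, `11907 = 3⁵·7²`).
BSD is not proved by this. [cite: Pollack2003, Conj. 6.3] -/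
theorem cuspSpanEvenAtTwo_primePow_mul_primePow {p q a b : ℕ} (hp : p.Prime) (hq : q.Prime) (hp2 : p ≠ 2) (hq2 : q ≠ 2)
    [NeZero (p ^ a * q ^ b)] : CuspSpanEvenAtTwo (p ^ a * q ^ b) := by
  refine cuspSpanEvenAtTwo_of_card_primeFactors_le_two ?_ ?_
  · exact (((hp.odd_of_ne_two hp2).pow).mul ((hq.odd_of_ne_two hq2).pow))
  · have hsub : (p ^ a * q ^ b).primeFactors ⊆ {p, q} := by
      intro r hr
      have hr' := Nat.mem_primeFactors.mp hr
      rcases (Nat.Prime.dvd_mul hr'.1).mp hr'.2.1 with h | h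
      · have := (Nat.prime_dvd_prime_iff_eq hr'.1 hp).mp (hr'.1.dvd_of_dvd_pow h)
        simp [this]
      · have := (Nat.prime_dvd_prime_iff_eq hr'.1 hq).mp (hr'.1.dvd_of_dvd_pow h)
        simp [this]
    exact (Finset.card_le_card hsub).trans (Finset.card_le_two)

end TwoPow

/-! ## FLAT for habitat⁺ curves whose conductor has at most two distinct prime factors -/

section Flat

variable {W : WeierstrassCurve ℚ} [W.IsElliptic] [W.IsGloballyMinimal]

/-- **FLAT at every odd conductor with at most two distinct prime factors.** For `W/ℚ` good supersingular at `2` with `a₂(W) = 0`,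
newform `f`, and `ω(N_W) ≤ 2` (`N_W` odd): `2 ∤ L⁻` for every Pollack pair `(L⁺, L⁻)` of `f` at `2`. BSD is not proved by this.
[cite: Pollack2003, Conj. 6.3 and Prop. 6.18] -/
theorem flatAtTwo_of_conductor_card_primeFactors_le_two [NeZero (W.conductorNorm ℤ)]
    {f : CuspForm (Gamma0 (W.conductorNorm ℤ)) 2}
    (hf : IsNewformOf W f) (hss : GoodSS W 2) (ha2 : W.frobeniusTrace 2 = 0)
    (hodd : Odd (W.conductorNorm ℤ)) (hω : (W.conductorNorm ℤ).primeFactors.card ≤ 2) :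
    ∀ Lplus Lminus : IwasawaAlgebra 2, IsPollackPair f 2 Lplus Lminus → ¬ PowerSeries.C (2 : ℤ_[2]) ∣ Lminus :=
  flatAtTwo_of_cuspSpanEvenAtTwo hf hss ha2 (TwoPow.cuspSpanEvenAtTwo_of_card_primeFactors_le_two hodd hω)

end Flat

end Summit.BirchSwinnertonDyer.BirchSwinnertonDyer.Theorems.SignedMuAtTwo

end
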